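import Literature.NumberTheory.Automorphic.UnipotentConjHaarChar
import Literature.NumberTheory.Automorphic.GLnMaximalCompactCompact
import Literature.NumberTheory.Automorphic.SiegelMultiplicity
import Literature.NumberTheory.Automorphic.ParabolicSemidirect
import HarnessLib

/-!
# The Borel part `B(𝔸_K) ∩ K` of the standard maximal compact subgroup, and Levi/unipotent
# coordinates on `B(𝔸_K)`

A brick of the proof of the Borel–Harish-Chandra finiteness theorem for `GL_n`
(`AdelicGroupData.exists_isAutomorphicMeasure_gl`): in the computation of the Haar measure of a
Siegel set `Ω A_{T₀}(t) K` through `GL_n(𝔸_K) = B(𝔸_K) K` and `B = T ⋉ N`, the elements of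
`B(𝔸_K) ∩ K` intervene through their unipotent parts, and one needs that these are not expanded
when the Siegel cone contracts `N(𝔸_K)` at the archimedean places. Proved here:

* `fst_apply_eq_zero_of_mem_standardMaximalCompactGL` — an upper triangular element of
  `K = K_∞ GL_n(𝒪̂_K)` has diagonal archimedean component (`apply_eq_zero_of_star_mul_self_of_blockTriangular`:
  a unitary upper triangular matrix is diagonal);
* `coe_leviPart_id_apply`, `apply_eq_zero_of_mem_leviP_id`, `mem_leviP_id_of_apply_eq_zero`,
  `mul_comm_of_mem_leviP_id`, `glDiagonal_mem_leviP_id` — the Levi subgroup of the Borel `P_id` is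
  the (commutative) diagonal torus; `coe_unipotentPart_id_apply` — entries of the unipotent part
  `ℓ(p)⁻¹ p`;
* `fst_apply_unipotentPart_eq_zero` — the unipotent part of `κ ∈ B ∩ K` has trivial archimedean
  component off the diagonal; `unipotentDiagConj_posRealIdele_eq_self` — such unipotents are fixed
  by conjugation with positive real diagonal matrices.

Everything is proved; theorems only.
-/

noncomputable section

open MeasureTheory NumberField IsDedekindDomain Matrix Set
open scoped MatrixGroups NNReal Pointwise Classical

namespace Literature.NumberTheory.Automorphic

/-! ### Upper triangular elements of `K = K_∞ · GL_n(𝒪̂_K)` have diagonal archimedean part -/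

section CompactBorel

variable {n : ℕ} {K : Type} [Field K] [NumberField K]

/-- **An upper triangular unitary matrix is diagonal** (over any commutative star ring in which
matrices have the star operation `M ↦ Mᴴ`): if `g ∈ GL_N(A)` satisfies `g* g = 1` and `g` is
upper triangular then `g⁻¹ = g*` is upper triangular as well, i.e. `g` is also lower triangular.
[folklore] -/
theorem apply_eq_zero_of_star_mul_self_of_blockTriangular {N : Type*} [Fintype N] [DecidableEq N]
    [LinearOrder N] {A : Type*} [CommRing A] [StarRing A] {g : GL N A}
    (hu : star (g : Matrix N N A) * g = 1) (hT : (g : Matrix N N A).BlockTriangular id)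
    {a b : N} (hab : a ≠ b) : (g : Matrix N N A) a b = 0 := by
  rcases lt_or_gt_of_ne hab with h | h
  · -- `a < b`: use that `g⁻¹ = g*` is upper triangular
    have hinv : ((g : Matrix N N A))⁻¹.BlockTriangular id :=
      Matrix.blockTriangular_inv_of_blockTriangular hT
    have hstar : star (g : Matrix N N A) = (g : Matrix N N A)⁻¹ :=
      (Matrix.inv_eq_left_inv hu).symm
    have h1 : ((g : Matrix N N A))⁻¹ b a = 0 := hinv h
    rw [← hstar, Matrix.star_apply] at h1
    simpa using congrArg star h1
  · exact hT h

/-- **Upper triangular elements of `K` have diagonal archimedean component.** If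
`κ ∈ K = K_∞ · GL_n(𝒪̂_K)` (`standardMaximalCompactGL`) is upper triangular, then the archimedean
components of its off-diagonal entries vanish: `κ = (k, 1) · (1, k')` with `k ∈ K_∞ = U(n, K_∞)`
unitary and upper triangular, hence diagonal. [folklore] -/
theorem fst_apply_eq_zero_of_mem_standardMaximalCompactGL {κ : GL (Fin n) (AdeleRing (𝓞 K) K)}
    (hκK : κ ∈ standardMaximalCompactGL n K)
    (hκB : (κ : Matrix (Fin n) (Fin n) (AdeleRing (𝓞 K) K)).BlockTriangular id)
    {i j : Fin n} (hij : i ≠ j) :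
    ((κ : Matrix (Fin n) (Fin n) (AdeleRing (𝓞 K) K)) i j).1 = 0 := by
  set φ := InfiniteAdeleRing.ringEquiv_mixedSpace K with hφ
  have hmem : κ ∈ (standardMaximalCompactGL n K : Set (GL (Fin n) (AdeleRing (𝓞 K) K))) := hκK
  rw [coe_standardMaximalCompactGL_eq_mul] at hmem
  obtain ⟨k₁, hk₁, k₂, hk₂, hk⟩ := hmem
  obtain ⟨g, hg, rfl⟩ := (Subgroup.mem_map.1 hk₁)
  -- archimedean entries of `κ` are those of `g`: `κ_∞ = (g, 1)_∞ · (1, k')_∞ = g`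
  have hA : GLn.fstHom n K κ = (GLn.infiniteEquivMixed n K).symm g := by
    rw [← hk]
    change GLn.fstHom n K (GLn.ofInfinite n K g * k₂) = _
    rw [map_mul, GLn.fstHom_ofInfinite, (mem_glIntegralLevel_iff.1 hk₂).2, mul_one]
  have hent : ∀ a b : Fin n, ((κ : Matrix (Fin n) (Fin n) (AdeleRing (𝓞 K) K)) a b).1 =
      φ.symm ((g : Matrix (Fin n) (Fin n) (mixedEmbedding.mixedSpace K)) a b) := by
    intro a b
    change ((GLn.fstHom n K κ : GL (Fin n) (InfiniteAdeleRing K)) :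
      Matrix (Fin n) (Fin n) (InfiniteAdeleRing K)) a b = _
    rw [hA]
    rfl
  -- `g` is unitary and upper triangular, hence diagonal
  have hgu : star (g : Matrix (Fin n) (Fin n) (mixedEmbedding.mixedSpace K)) * g = 1 := by
    rw [Kinf_eq_unitarySubgroupGL] at hg
    exact (mem_unitarySubgroupGL_iff g).1 hg
  have hgT : (g : Matrix (Fin n) (Fin n) (mixedEmbedding.mixedSpace K)).BlockTriangular id := by
    intro a b hba
    have h0 : ((κ : Matrix (Fin n) (Fin n) (AdeleRing (𝓞 K) K)) a b).1 = 0 := by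
      rw [hκB hba]; rfl
    rw [hent] at h0
    simpa using congrArg φ h0
  have hgab : (g : Matrix (Fin n) (Fin n) (mixedEmbedding.mixedSpace K)) i j = 0 :=
    apply_eq_zero_of_star_mul_self_of_blockTriangular hgu hgT hij
  rw [hent, hgab, map_zero]

end CompactBorel

/-! ### Levi and unipotent coordinates on the Borel subgroup `B = P_id` -/

section BorelCoordinates

variable {R : Type*} [CommRing R] {n : ℕ}

/-- Entries of the **diagonal part** `ℓ(p)` of `p ∈ B(R)` (the Levi component for the labelling
`id`): `ℓ(p)ᵢⱼ = pᵢᵢ` if `i = j` and `0` otherwise. [folklore] -/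
theorem coe_leviPart_id_apply (p : standardParabolicGL R (id : Fin n → Fin n)) (i j : Fin n) :
    (((leviEmbeddingP R id (leviProjection R id p) : standardParabolicGL R (id : Fin n → Fin n)) :
        GL (Fin n) R) : Matrix (Fin n) (Fin n) R) i j =
      if i = j then ((p : GL (Fin n) R) : Matrix (Fin n) (Fin n) R) i j else 0 :=
  coe_leviEmbedding_leviProjection_apply (id : Fin n → Fin n) p i j

/-- Elements of the Levi subgroup `M_id ≤ B` (the diagonal torus) are diagonal matrices.
[folklore] -/
theorem apply_eq_zero_of_mem_leviP_id {p : standardParabolicGL R (id : Fin n → Fin n)}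
    (hp : p ∈ leviP R (id : Fin n → Fin n)) {i j : Fin n} (hij : i ≠ j) :
    ((p : GL (Fin n) R) : Matrix (Fin n) (Fin n) R) i j = 0 := by
  rw [mem_leviP_iff] at hp
  rw [← hp, coe_leviPart_id_apply, if_neg hij]

/-- A diagonal element of `B` lies in the Levi subgroup `M_id`. [folklore] -/
theorem mem_leviP_id_of_apply_eq_zero {p : standardParabolicGL R (id : Fin n → Fin n)}
    (hp : ∀ i j : Fin n, i ≠ j → ((p : GL (Fin n) R) : Matrix (Fin n) (Fin n) R) i j = 0) :
    p ∈ leviP R (id : Fin n → Fin n) := by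
  rw [mem_leviP_iff]
  refine Subtype.ext (Matrix.GeneralLinearGroup.ext fun i j => ?_)
  rw [coe_leviPart_id_apply]
  split_ifs with h
  · rfl
  · exact (hp i j h).symm

/-- The diagonal torus `M_id ≤ B` is commutative. [folklore] -/
theorem mul_comm_of_mem_leviP_id {a b : standardParabolicGL R (id : Fin n → Fin n)}
    (ha : a ∈ leviP R (id : Fin n → Fin n)) (hb : b ∈ leviP R (id : Fin n → Fin n)) :
    a * b = b * a := by
  have hda : ((a : GL (Fin n) R) : Matrix (Fin n) (Fin n) R) =
      Matrix.diagonal fun i => ((a : GL (Fin n) R) : Matrix (Fin n) (Fin n) R) i i := by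
    ext i j
    by_cases h : i = j
    · subst h; rw [Matrix.diagonal_apply_eq]
    · rw [Matrix.diagonal_apply_ne _ h, apply_eq_zero_of_mem_leviP_id ha h]
  have hdb : ((b : GL (Fin n) R) : Matrix (Fin n) (Fin n) R) =
      Matrix.diagonal fun i => ((b : GL (Fin n) R) : Matrix (Fin n) (Fin n) R) i i := by
    ext i j
    by_cases h : i = j
    · subst h; rw [Matrix.diagonal_apply_eq]
    · rw [Matrix.diagonal_apply_ne _ h, apply_eq_zero_of_mem_leviP_id hb h]
  refine Subtype.ext (Units.ext ?_)
  change ((a : GL (Fin n) R) : Matrix (Fin n) (Fin n) R) * ((b : GL (Fin n) R) : Matrix _ _ R) =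
    ((b : GL (Fin n) R) : Matrix (Fin n) (Fin n) R) * ((a : GL (Fin n) R) : Matrix _ _ R)
  rw [hda, hdb, Matrix.diagonal_mul_diagonal, Matrix.diagonal_mul_diagonal]
  congr 1
  funext i
  exact mul_comm _ _

/-- A diagonal matrix `diag(d) ∈ B` lies in the Levi subgroup `M_id`. [folklore] -/
theorem glDiagonal_mem_leviP_id (d : Fin n → Rˣ) :
    (⟨glDiagonal n R d, glDiagonal_mem_standardParabolicGL d⟩ :
        standardParabolicGL R (id : Fin n → Fin n)) ∈ leviP R (id : Fin n → Fin n) := by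
  refine mem_leviP_id_of_apply_eq_zero fun i j hij => ?_
  change ((glDiagonal n R d : GL (Fin n) R) : Matrix (Fin n) (Fin n) R) i j = 0
  rw [coe_glDiagonal, Matrix.diagonal_apply_ne _ hij]

/-- Entries of the **unipotent part** `ℓ(p)⁻¹ p` of `p ∈ B(R)`: `(ℓ(p)⁻¹ p)ᵢⱼ = (p⁻¹)ᵢᵢ · pᵢⱼ`.
[folklore] -/
theorem coe_unipotentPart_id_apply (p : standardParabolicGL R (id : Fin n → Fin n)) (i j : Fin n) :
    ((((leviEmbeddingP R id (leviProjection R id p))⁻¹ * p :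
        standardParabolicGL R (id : Fin n → Fin n)) : GL (Fin n) R) : Matrix (Fin n) (Fin n) R) i j =
      (((p : GL (Fin n) R)⁻¹ : GL (Fin n) R) : Matrix (Fin n) (Fin n) R) i i *
        ((p : GL (Fin n) R) : Matrix (Fin n) (Fin n) R) i j := by
  rw [← map_inv, ← map_inv, Subgroup.coe_mul, Units.val_mul, Matrix.mul_apply,
    Finset.sum_eq_single i]
  · rw [coe_leviPart_id_apply, if_pos rfl]
    rfl
  · intro m _ hmi
    rw [coe_leviPart_id_apply, if_neg (Ne.symm hmi), zero_mul]
  · intro h; exact absurd (Finset.mem_univ i) h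

end BorelCoordinates

/-! ### Archimedean-trivial unipotents are fixed by positive real diagonal conjugation -/

section ArchTrivial

variable {n : ℕ} {K : Type} [Field K] [NumberField K]

/-- **The unipotent part of an upper triangular element of `K` has trivial archimedean
component off the diagonal**: for `κ ∈ B(𝔸_K) ∩ K`, `((ℓ(κ)⁻¹ κ)ᵢⱼ)_∞ = 0` for `i ≠ j`.
[folklore] -/
theorem fst_apply_unipotentPart_eq_zero {κ : GL (Fin n) (AdeleRing (𝓞 K) K)}
    (hκK : κ ∈ standardMaximalCompactGL n K)
    (hκB : κ ∈ standardParabolicGL (AdeleRing (𝓞 K) K) (id : Fin n → Fin n))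
    {i j : Fin n} (hij : i ≠ j) :
    (((((leviEmbeddingP (AdeleRing (𝓞 K) K) id
        (leviProjection (AdeleRing (𝓞 K) K) id ⟨κ, hκB⟩))⁻¹ * ⟨κ, hκB⟩ :
          standardParabolicGL (AdeleRing (𝓞 K) K) (id : Fin n → Fin n)) :
        GL (Fin n) (AdeleRing (𝓞 K) K)) : Matrix (Fin n) (Fin n) (AdeleRing (𝓞 K) K)) i j).1 = 0 := by
  rw [coe_unipotentPart_id_apply]
  change (((κ⁻¹ : GL (Fin n) (AdeleRing (𝓞 K) K)) : Matrix (Fin n) (Fin n) (AdeleRing (𝓞 K) K))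
      i i).1 * ((κ : Matrix (Fin n) (Fin n) (AdeleRing (𝓞 K) K)) i j).1 = 0
  rw [fst_apply_eq_zero_of_mem_standardMaximalCompactGL hκK hκB hij, mul_zero]

/-- **Positive real diagonal conjugation fixes archimedean-trivial unipotents.** If
`u ∈ N_n(𝔸_K)` has vanishing archimedean components off the diagonal, then
`diag(z(e)) u diag(z(e))⁻¹ = u` for every positive real `e`: the conjugation multiplies `uᵢⱼ`
by the real scalar `eᵢ/eⱼ` at the archimedean places only. [folklore] -/
theorem unipotentDiagConj_posRealIdele_eq_self (e : Fin n → ℝ≥0ˣ) {u : ↥(adelicUnipotent n K)}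
    (hu : ∀ i j : Fin n, i ≠ j →
      (((u : GL (Fin n) (AdeleRing (𝓞 K) K)) : Matrix (Fin n) (Fin n) (AdeleRing (𝓞 K) K)) i j).1 = 0) :
    unipotentDiagConj (fun k => posRealIdele K (e k)) u = u := by
  refine Subtype.ext (Matrix.GeneralLinearGroup.ext fun i j => ?_)
  rw [coe_unipotentDiagConj_posRealIdele_apply]
  by_cases hij : i = j
  · subst hij
    rw [mul_inv_cancel, Units.val_one, NNReal.coe_one, realAdele_one, one_mul]
  · refine Prod.ext ?_ ?_
    · have h1 : ∀ (ρ : ℝ) (x : AdeleRing (𝓞 K) K), (realAdele K ρ * x).1 = realToInfiniteAdele K ρ * x.1 :=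
        fun ρ x => rfl
      rw [h1, hu i j hij, mul_zero]
    · exact snd_realAdele_mul _ _

end ArchTrivial

end Literature.NumberTheory.Automorphic
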